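import Literature.Geometry.Lorentzian.IMCFNormalVariation
import Literature.Geometry.Lorentzian.GradientSection
import Literature.Geometry.Lorentzian.TwoParameterCurvature
import Literature.Geometry.Lorentzian.GaussFormulaTangential
import Literature.Geometry.Lorentzian.LeviCivitaProofs
import HarnessLib

/-!
# Evolution of the second fundamental form along a classical inverse mean curvature flow

For a classical solution `F` of inverse mean curvature flow (`IsClassicalIMCF`, Huisken–Ilmanen
2001, §0 (∗): `∂_t F = H⁻¹ ν`) the second fundamental form of the leaves evolves by
`∂_t K(∂ₐ, ∂_c) = −Hess(H⁻¹)(∂ₐ, ∂_c) + H⁻¹ Rm(ν, ∂ₐ, ν, ∂_c) + H⁻¹ (K²)(∂ₐ, ∂_c)` — the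
computation behind the evolution equation (1.3) of the mean curvature (Huisken–Ilmanen 2001,
§1; Huisken–Polden 1999, Thm. 3.2 for general normal speeds). Main statement:

* `IsClassicalIMCF.hasDerivAt_secondFundamentalForm` — at `t₀ ∈ (a, b)`, `p ∈ S`, for a basis
  `b₂` of the model plane, `t ↦ K_{ν_t}(b₂ a, b₂ c)` has derivative
  `−Hess_g(H⁻¹)(b₂ a, b₂ c) + H⁻¹ h(R(ν, dF b₂ a)ν, dF b₂ c) + H⁻¹ h(D_{b₂ a}ν, D_{b₂ c}ν)`.

Ingredients (all proved here): the Hessian term `val_covariantDerivAlong_mfderiv_grad_chartLine`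
(metric compatibility along a coordinate line, the tangential Gauss formula
`val_covariantDerivAlong_mfderiv_localFrame_chartLine` and `Hess f(X,Y) = X(Yf) − df(∇_X Y)`);
the normal term `val_normalDerivAlong_covariantDerivAlong_velocity` (`D_t dF w = D_w(H⁻¹ν)`);
the time derivative of `D_{∂ₐ}ν` paired with a tangent vector,
`val_covariantDerivAlong_normalDerivAlong_time` (`D_t D_σ ν = D_σ D_t ν + R(x_t, x_σ)ν` for the
two-parameter map `(t, σ) ↦ F t (c σ)`, O'Neill 1983, Ch. 4, Prop. 4.44 (2), and
`D_t ν = −dF(grad H⁻¹)`, `IMCFNormalVariation.lean`); and the regularity of the lifts involved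
(`contMDiffAt_lift_normal_uncurry_curveThrough`, `mdifferentiableAt_lift_normalDerivAlong_time`).

Everything is proved; there are no definitions and no named facts.

## References

* G. Huisken, T. Ilmanen, *The inverse mean curvature flow and the Riemannian Penrose
  inequality*, J. Differential Geom. 59 (2001) 353–437: §1, (1.1)–(1.3).
* G. Huisken, A. Polden, *Geometric evolution equations for hypersurfaces*, LNM 1713 (1999),
  Thm. 3.2.
* B. O'Neill, *Semi-Riemannian geometry*, Academic Press 1983, Ch. 3, Lemma 3.49; Ch. 4,
  Prop. 4.44.
-/

noncomputable section

open Bundle Set Manifold TopologicalSpace Filter Function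
open scoped ContDiff Topology Manifold

namespace Literature.Geometry.Lorentzian

open PseudoRiemannianMetric

variable {X : Type*} [TopologicalSpace X] [ChartedSpace E3 X] [IsManifold (𝓡 3) ∞ X]
  {h : ContMDiffRiemannianMetric (𝓡 3) ∞ E3 (TangentSpace (𝓡 3) : X → Type _)}
  [(ofRiemannian h).HasLeviCivita]
  {S : Type*} [TopologicalSpace S] [ChartedSpace (EuclideanSpace ℝ (Fin 2)) S]
  [IsManifold (𝓡 2) ∞ S] {hpb : contMDiff_pullbackBilin (𝓡 3) X (𝓡 2) S ∞}
  {F : ℝ → S → X} {ν : (t : ℝ) → NormalField (𝓡 3) (F t)} {a b : ℝ}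
  {ι : Type*} [Fintype ι] [DecidableEq ι]

namespace IsClassicalIMCF

set_option maxHeartbeats 800000 in
/-- **The Hessian term.** For a classical solution, `t₀ ∈ (a, b)`, `p ∈ S`, a basis `b₂` of the
model plane (so that the coordinate frame `∂ₐ` of the chart `φ` of `S` at `p` satisfies
`∂ₐ(p) = b₂ a`) and the gradient section `W = grad_{g}(H⁻¹)`, `g = F_{t₀}^* h`, of the inverse
mean curvature at time `t₀`: the covariant derivative at `0`, along the image of the `a`-th
coordinate line through `p`, of the field `dF_{t₀}(W)`, paired with `dF_{t₀}(b₂ c)`, is the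
Hessian `Hess_g(H⁻¹)_p(b₂ a, b₂ c)`. Proof: metric compatibility along the line for the fields
`dF(W)`, `dF(∂_c)` (`hasDerivAt_val_apply_along`), `h(dF W, dF ∂_c) = g(W, ∂_c) = ∂_c(H⁻¹)` along
the line, the tangential Gauss formula `h(D_{∂ₐ}(dF ∂_c), dF ∂_b) = g(∇_{∂ₐ}∂_c, ∂_b)`
(`val_covariantDerivAlong_mfderiv_localFrame_chartLine` with the symmetry
`covariantDerivAlong_mfderiv_localFrame_chartLine_comm`), and `Hess f(X, Y) = X(Yf) − df(∇_X Y)`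
(`hessian_apply_holds`). O'Neill 1983, Ch. 3, Def. 3.48, Lemma 3.49 (Hessian); Huisken–Ilmanen
2001, §1 (the term `−∇²(H⁻¹)` of the evolution of `A` under (∗)).
[cite: ONeill1983, Ch. 3, Lemma 3.49] -/
theorem val_covariantDerivAlong_mfderiv_grad_chartLine (Hc : IsClassicalIMCF h hpb F ν a b)
    {t₀ : ℝ} (ht₀ : t₀ ∈ Set.Ioo a b) (p : S) (b₂ : Module.Basis ι ℝ (EuclideanSpace ℝ (Fin 2)))
    (a' c : ι) :
    haveI := ((ofRiemannian h).inducedMetric (F t₀) hpb (Hc.isSpacelikeImmersion t₀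
        ht₀)).hasLeviCivita
    (ofRiemannian h).val (F t₀ p)
        (covariantDerivAlong (ofRiemannian h).leviCivita
          (fun σ : ℝ ↦ F t₀ ((extChartAt (𝓡 2) p).symm (extChartAt (𝓡 2) p p + σ • b₂ a')))
          (fun σ ↦ mfderiv (𝓡 2) (𝓡 3) (F t₀)
            ((extChartAt (𝓡 2) p).symm (extChartAt (𝓡 2) p p + σ • b₂ a'))
            (((ofRiemannian h).inducedMetric (F t₀) hpb (Hc.isSpacelikeImmersion t₀ ht₀)).sharp
              ((extChartAt (𝓡 2) p).symm (extChartAt (𝓡 2) p p + σ • b₂ a'))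
              (mvfderiv (𝓡 2) (fun y ↦ ((ofRiemannian h).meanCurvature (F t₀) hpb
                (Hc.isSpacelikeImmersion t₀ ht₀) (ν t₀) y)⁻¹)
                ((extChartAt (𝓡 2) p).symm (extChartAt (𝓡 2) p p + σ • b₂ a'))).toLinearMap)) 0)
        (mfderiv (𝓡 2) (𝓡 3) (F t₀) p (b₂ c)) =
      ((ofRiemannian h).inducedMetric (F t₀) hpb (Hc.isSpacelikeImmersion t₀ ht₀)).hessian
        (fun y ↦ ((ofRiemannian h).meanCurvature (F t₀) hpb (Hc.isSpacelikeImmersion t₀ ht₀)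
          (ν t₀) y)⁻¹) p (b₂ a') (b₂ c) := by
  set g := ofRiemannian h with hg
  set gN := g.inducedMetric (F t₀) hpb (Hc.isSpacelikeImmersion t₀ ht₀) with hgN
  haveI := gN.hasLeviCivita
  set f : S → ℝ := fun y ↦ (g.meanCurvature (F t₀) hpb (Hc.isSpacelikeImmersion t₀ ht₀) (ν t₀) y)⁻¹
    with hf_def
  set W : Π y : S, TangentSpace (𝓡 2) y := fun y ↦ gN.sharp y (mvfderiv (𝓡 2) f y).toLinearMap
    with hW_def
  have hcompat := (isLeviCivita_leviCivita_holds (g := g)).2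
  have hp : p ∈ (chartAt (EuclideanSpace ℝ (Fin 2)) p).source := mem_chart_source _ p
  have hz := extChartAt_mem_target_of_mem_source (I' := 𝓡 2) hp
  have hp0 := extChartAt_symm_apply_add_zero_smul (I' := 𝓡 2) hp (b₂ a')
  have hI1 : IsManifold (𝓡 2) (1 + 1) S := inferInstanceAs (IsManifold (𝓡 2) 2 S)
  have hVB : ContMDiffVectorBundle 1 (EuclideanSpace ℝ (Fin 2)) (TangentSpace (𝓡 2) : S → Type _)
      (𝓡 2) := TangentBundle.contMDiffVectorBundle
  have hF2 : ContMDiff (𝓡 2) (𝓡 3) 2 (F t₀) :=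
    (Hc.isSpacelikeImmersion t₀ ht₀).contMDiff_self.of_le (by exact WithTop.coe_le_coe.2 le_top)
  -- smoothness of `f` and differentiability of the gradient section
  have hfs : ContMDiff (𝓡 2) 𝓘(ℝ, ℝ) ∞ f :=
    (Hc.contMDiff_meanCurvature ht₀).inv₀ fun y ↦ (Hc.meanCurvature_pos t₀ ht₀ y).ne'
  have hf2 : ∀ y, ContMDiffAt (𝓡 2) 𝓘(ℝ, ℝ) 2 f y := fun y ↦
    (hfs y).of_le (by exact WithTop.coe_le_coe.2 le_top)
  have hW : ∀ y, MDifferentiableAt (𝓡 2) (𝓡 2).tangent (fun y ↦ (TotalSpace.mk'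
      (EuclideanSpace ℝ (Fin 2)) y (W y) : TangentBundle (𝓡 2) S)) y := fun y ↦
    gN.mdifferentiableAt_sharp_mvfderiv (hf2 y)
  -- the frame and the line
  have hsd : ∀ e, MDifferentiableAt (𝓡 2) (𝓡 2).tangent (fun y ↦ (TotalSpace.mk'
      (EuclideanSpace ℝ (Fin 2)) y ((trivializationAt (EuclideanSpace ℝ (Fin 2))
        (TangentSpace (𝓡 2)) p).localFrame b₂ e y) : TangentBundle (𝓡 2) S))
      ((extChartAt (𝓡 2) p).symm (extChartAt (𝓡 2) p p + (0 : ℝ) • b₂ a')) := by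
    rw [hp0]
    exact fun e ↦ (contMDiffAt_localFrame_of_mem 1 _ b₂ e (by simp)).mdifferentiableAt
      one_ne_zero
  have hγ : MDifferentiableAt 𝓘(ℝ, ℝ) (𝓡 2)
      (fun σ : ℝ ↦ (extChartAt (𝓡 2) p).symm (extChartAt (𝓡 2) p p + σ • b₂ a')) 0 :=
    (contMDiffAt_chartLine hz _).mdifferentiableAt (by simp)
  -- lifts of the two fields along the line
  have hVl : MDifferentiableAt 𝓘(ℝ, ℝ) (𝓡 3).tangent (fun σ : ℝ ↦ (TotalSpace.mk' E3
      (F t₀ ((extChartAt (𝓡 2) p).symm (extChartAt (𝓡 2) p p + σ • b₂ a')))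
      (mfderiv (𝓡 2) (𝓡 3) (F t₀) ((extChartAt (𝓡 2) p).symm (extChartAt (𝓡 2) p p + σ • b₂ a'))
        (W ((extChartAt (𝓡 2) p).symm (extChartAt (𝓡 2) p p + σ • b₂ a')))) :
          TangentBundle (𝓡 3) X)) 0 :=
    mdifferentiableAt_lift_comp_curve (I := 𝓡 3) (f := F t₀)
      (Y := fun z ↦ mfderiv (𝓡 2) (𝓡 3) (F t₀) z (W z))
      (c := fun σ : ℝ ↦ (extChartAt (𝓡 2) p).symm (extChartAt (𝓡 2) p p + σ • b₂ a')) hγ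
      (mdifferentiableAt_lift_mfderiv hF2 (hW _))
  have hYl : MDifferentiableAt 𝓘(ℝ, ℝ) (𝓡 3).tangent (fun σ : ℝ ↦ (TotalSpace.mk' E3
      (F t₀ ((extChartAt (𝓡 2) p).symm (extChartAt (𝓡 2) p p + σ • b₂ a')))
      (mfderiv (𝓡 2) (𝓡 3) (F t₀) ((extChartAt (𝓡 2) p).symm (extChartAt (𝓡 2) p p + σ • b₂ a'))
        ((trivializationAt (EuclideanSpace ℝ (Fin 2)) (TangentSpace (𝓡 2)) p).localFrame b₂ c
          ((extChartAt (𝓡 2) p).symm (extChartAt (𝓡 2) p p + σ • b₂ a')))) :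
            TangentBundle (𝓡 3) X)) 0 :=
    mdifferentiableAt_lift_comp_curve (I := 𝓡 3) (f := F t₀)
      (Y := fun z ↦ mfderiv (𝓡 2) (𝓡 3) (F t₀) z
        ((trivializationAt (EuclideanSpace ℝ (Fin 2)) (TangentSpace (𝓡 2)) p).localFrame b₂ c z))
      (c := fun σ : ℝ ↦ (extChartAt (𝓡 2) p).symm (extChartAt (𝓡 2) p p + σ • b₂ a')) hγ
      (mdifferentiableAt_lift_mfderiv hF2 (hsd c))
  have hd := g.hasDerivAt_val_apply_along hcompat hVl hYl
  -- the paired function is `σ ↦ ∂_c f (line σ)`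
  have hfun : (fun σ : ℝ ↦ g.val (F t₀ ((extChartAt (𝓡 2) p).symm (extChartAt (𝓡 2) p p + σ • b₂
      a')))
      (mfderiv (𝓡 2) (𝓡 3) (F t₀) ((extChartAt (𝓡 2) p).symm (extChartAt (𝓡 2) p p + σ • b₂ a'))
        (W ((extChartAt (𝓡 2) p).symm (extChartAt (𝓡 2) p p + σ • b₂ a'))))
      (mfderiv (𝓡 2) (𝓡 3) (F t₀) ((extChartAt (𝓡 2) p).symm (extChartAt (𝓡 2) p p + σ • b₂ a'))
        ((trivializationAt (EuclideanSpace ℝ (Fin 2)) (TangentSpace (𝓡 2)) p).localFrame b₂ c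
          ((extChartAt (𝓡 2) p).symm (extChartAt (𝓡 2) p p + σ • b₂ a'))))) =
      fun σ ↦ mvfderiv (𝓡 2) f ((extChartAt (𝓡 2) p).symm (extChartAt (𝓡 2) p p + σ • b₂ a'))
        ((trivializationAt (EuclideanSpace ℝ (Fin 2)) (TangentSpace (𝓡 2)) p).localFrame b₂ c
          ((extChartAt (𝓡 2) p).symm (extChartAt (𝓡 2) p p + σ • b₂ a'))) := by
    funext σ
    show gN.val _ (W _) _ = _
    rw [hW_def, val_sharp_apply]
    rfl
  rw [hfun] at hd
  -- derivative of `σ ↦ ∂_c f (line σ)` at `0`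
  have hcf : ContMDiffAt (𝓡 2) 𝓘(ℝ, ℝ) 1 (fun y ↦ mvfderiv (𝓡 2) f y
      ((trivializationAt (EuclideanSpace ℝ (Fin 2)) (TangentSpace (𝓡 2)) p).localFrame b₂ c y)) p :=
    contMDiffAt_mvfderiv_localFrame b₂ hp (hf2 p) c
  have hderiv : HasDerivAt (fun σ : ℝ ↦ mvfderiv (𝓡 2) f
      ((extChartAt (𝓡 2) p).symm (extChartAt (𝓡 2) p p + σ • b₂ a'))
      ((trivializationAt (EuclideanSpace ℝ (Fin 2)) (TangentSpace (𝓡 2)) p).localFrame b₂ c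
        ((extChartAt (𝓡 2) p).symm (extChartAt (𝓡 2) p p + σ • b₂ a'))))
      (mvfderiv (𝓡 2) (fun y ↦ mvfderiv (𝓡 2) f y
        ((trivializationAt (EuclideanSpace ℝ (Fin 2)) (TangentSpace (𝓡 2)) p).localFrame b₂ c y)) p
        ((trivializationAt (EuclideanSpace ℝ (Fin 2)) (TangentSpace (𝓡 2)) p).localFrame b₂ a' p))
      0 := by
    have key : ∀ z (hz : p = z) (u : TangentSpace (𝓡 2) z),
        (show EuclideanSpace ℝ (Fin 2) from u) =
          (trivializationAt (EuclideanSpace ℝ (Fin 2)) (TangentSpace (𝓡 2)) p).localFrame b₂ a' p →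
        HasDerivAt (fun σ : ℝ ↦ mvfderiv (𝓡 2) f
          ((extChartAt (𝓡 2) p).symm (extChartAt (𝓡 2) p p + σ • b₂ a'))
          ((trivializationAt (EuclideanSpace ℝ (Fin 2)) (TangentSpace (𝓡 2)) p).localFrame b₂ c
            ((extChartAt (𝓡 2) p).symm (extChartAt (𝓡 2) p p + σ • b₂ a'))))
          (mfderiv (𝓡 2) 𝓘(ℝ, ℝ) (fun y ↦ mvfderiv (𝓡 2) f y
            ((trivializationAt (EuclideanSpace ℝ (Fin 2)) (TangentSpace (𝓡 2)) p).localFrame b₂ c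
              y)) z u) 0 →
        HasDerivAt (fun σ : ℝ ↦ mvfderiv (𝓡 2) f
          ((extChartAt (𝓡 2) p).symm (extChartAt (𝓡 2) p p + σ • b₂ a'))
          ((trivializationAt (EuclideanSpace ℝ (Fin 2)) (TangentSpace (𝓡 2)) p).localFrame b₂ c
            ((extChartAt (𝓡 2) p).symm (extChartAt (𝓡 2) p p + σ • b₂ a'))))
          (mvfderiv (𝓡 2) (fun y ↦ mvfderiv (𝓡 2) f y
            ((trivializationAt (EuclideanSpace ℝ (Fin 2)) (TangentSpace (𝓡 2)) p).localFrame b₂ c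
              y)) p
            ((trivializationAt (EuclideanSpace ℝ (Fin 2)) (TangentSpace (𝓡 2)) p).localFrame b₂ a'
              p)) 0 := by
      rintro z rfl u rfl h1; exact h1
    have hcf' : MDifferentiableAt (𝓡 2) 𝓘(ℝ, ℝ) (fun y ↦ mvfderiv (𝓡 2) f y
        ((trivializationAt (EuclideanSpace ℝ (Fin 2)) (TangentSpace (𝓡 2)) p).localFrame b₂ c y))
        ((extChartAt (𝓡 2) p).symm (extChartAt (𝓡 2) p p + (0 : ℝ) • b₂ a')) := by
      rw [hp0]; exact hcf.mdifferentiableAt one_ne_zero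
    have h1 := hasDerivAt_comp_curve hcf' hγ
    refine key _ hp0.symm _ ?_ h1
    show (velocity (𝓡 2) (fun σ : ℝ ↦ (extChartAt (𝓡 2) p).symm
      (extChartAt (𝓡 2) p p + σ • b₂ a')) 0 : EuclideanSpace ℝ (Fin 2)) = _
    rw [velocity_chartLine b₂ hz (b₂ a'), sum_coord_basis_smul,
      (extChartAt (𝓡 2) p).left_inv (mem_extChartAt_source p)]
  have huniq := hd.unique hderiv
  -- the frame at `p`
  have hsp : ∀ e, MDifferentiableAt (𝓡 2) (𝓡 2).tangent (fun y ↦ (TotalSpace.mk'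
      (EuclideanSpace ℝ (Fin 2)) y ((trivializationAt (EuclideanSpace ℝ (Fin 2))
        (TangentSpace (𝓡 2)) p).localFrame b₂ e y) : TangentBundle (𝓡 2) S)) p := fun e ↦
    (contMDiffAt_localFrame_of_mem 1 _ b₂ e (by simp)).mdifferentiableAt one_ne_zero
  have hpe : p ∈ (trivializationAt (EuclideanSpace ℝ (Fin 2)) (TangentSpace (𝓡 2)) p).baseSet := by
    simp
  -- (2) the second term, at `p`: `h(dF W, D_{∂ₐ}(dF ∂_c)) = df(∇_{∂ₐ} ∂_c)`
  have hsecond : g.val (F t₀ p) (mfderiv (𝓡 2) (𝓡 3) (F t₀) p (W p))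
      (show TangentSpace (𝓡 3) (F t₀ p) from covariantDerivAlong g.leviCivita
        (fun σ : ℝ ↦ F t₀ ((extChartAt (𝓡 2) p).symm (extChartAt (𝓡 2) p p + σ • b₂ a')))
        (fun σ ↦ mfderiv (𝓡 2) (𝓡 3) (F t₀)
          ((extChartAt (𝓡 2) p).symm (extChartAt (𝓡 2) p p + σ • b₂ a'))
          ((trivializationAt (EuclideanSpace ℝ (Fin 2)) (TangentSpace (𝓡 2)) p).localFrame b₂ c
            ((extChartAt (𝓡 2) p).symm (extChartAt (𝓡 2) p p + σ • b₂ a')))) 0) =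
      mvfderiv (𝓡 2) f p (gN.leviCivita
        ((trivializationAt (EuclideanSpace ℝ (Fin 2)) (TangentSpace (𝓡 2)) p).localFrame b₂ c) p
        ((trivializationAt (EuclideanSpace ℝ (Fin 2)) (TangentSpace (𝓡 2)) p).localFrame b₂ a' p))
            := by
    have hWp := (trivializationAt (EuclideanSpace ℝ (Fin 2)) (TangentSpace (𝓡 2)) p)
      |>.eq_sum_localFrame_coeff_smul (I := 𝓡 2) (b := b₂) (s := W) hpe
    have hcore : ∀ e, g.val (F t₀ p)
        (show TangentSpace (𝓡 3) (F t₀ p) from covariantDerivAlong g.leviCivita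
          (fun σ : ℝ ↦ F t₀ ((extChartAt (𝓡 2) p).symm (extChartAt (𝓡 2) p p + σ • b₂ a')))
          (fun σ ↦ mfderiv (𝓡 2) (𝓡 3) (F t₀)
            ((extChartAt (𝓡 2) p).symm (extChartAt (𝓡 2) p p + σ • b₂ a'))
            ((trivializationAt (EuclideanSpace ℝ (Fin 2)) (TangentSpace (𝓡 2)) p).localFrame b₂ c
              ((extChartAt (𝓡 2) p).symm (extChartAt (𝓡 2) p p + σ • b₂ a')))) 0)
        (mfderiv (𝓡 2) (𝓡 3) (F t₀) p
          ((trivializationAt (EuclideanSpace ℝ (Fin 2)) (TangentSpace (𝓡 2)) p).localFrame b₂ e p))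
              =
        gN.val p (gN.leviCivita
          ((trivializationAt (EuclideanSpace ℝ (Fin 2)) (TangentSpace (𝓡 2)) p).localFrame b₂ c) p
          ((trivializationAt (EuclideanSpace ℝ (Fin 2)) (TangentSpace (𝓡 2)) p).localFrame b₂ a' p))
          ((trivializationAt (EuclideanSpace ℝ (Fin 2)) (TangentSpace (𝓡 2)) p).localFrame b₂ e p)
              :=
      fun e ↦ val_covariantDerivAlong_mfderiv_localFrame_chartLine g b₂ hpb
        (Hc.isSpacelikeImmersion t₀ ht₀) hp a' c e
    rw [g.symm (F t₀ p)]
    conv_lhs => rw [hWp]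
    simp only [map_sum, map_smul, smul_eq_mul, hcore]
    have hsw : gN.val p (W p) (gN.leviCivita
        ((trivializationAt (EuclideanSpace ℝ (Fin 2)) (TangentSpace (𝓡 2)) p).localFrame b₂ c) p
        ((trivializationAt (EuclideanSpace ℝ (Fin 2)) (TangentSpace (𝓡 2)) p).localFrame b₂ a' p)) =
        mvfderiv (𝓡 2) f p (gN.leviCivita
          ((trivializationAt (EuclideanSpace ℝ (Fin 2)) (TangentSpace (𝓡 2)) p).localFrame b₂ c) p
          ((trivializationAt (EuclideanSpace ℝ (Fin 2)) (TangentSpace (𝓡 2)) p).localFrame b₂ a'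
              p)) := by
      rw [hW_def, val_sharp_apply]; rfl
    rw [← hsw, gN.symm p (W p)]
    conv_rhs => rw [hWp]
    simp only [map_sum, map_smul, smul_eq_mul]
  -- transport of the second term to the form of `huniq`
  have hsecond' : ∀ q (hq : p = q) (w : TangentSpace (𝓡 2) q), (show EuclideanSpace ℝ (Fin 2) from
      w) =
      W p → g.val (F t₀ q) (mfderiv (𝓡 2) (𝓡 3) (F t₀) q w)
      (show TangentSpace (𝓡 3) (F t₀ q) from covariantDerivAlong g.leviCivita
        (fun σ : ℝ ↦ F t₀ ((extChartAt (𝓡 2) p).symm (extChartAt (𝓡 2) p p + σ • b₂ a')))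
        (fun σ ↦ mfderiv (𝓡 2) (𝓡 3) (F t₀)
          ((extChartAt (𝓡 2) p).symm (extChartAt (𝓡 2) p p + σ • b₂ a'))
          ((trivializationAt (EuclideanSpace ℝ (Fin 2)) (TangentSpace (𝓡 2)) p).localFrame b₂ c
            ((extChartAt (𝓡 2) p).symm (extChartAt (𝓡 2) p p + σ • b₂ a')))) 0) =
      mvfderiv (𝓡 2) f p (gN.leviCivita
        ((trivializationAt (EuclideanSpace ℝ (Fin 2)) (TangentSpace (𝓡 2)) p).localFrame b₂ c) p
        ((trivializationAt (EuclideanSpace ℝ (Fin 2)) (TangentSpace (𝓡 2)) p).localFrame b₂ a' p))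
            := by
    rintro q rfl w rfl; exact hsecond
  have hWc0 : (show EuclideanSpace ℝ (Fin 2) from
      W ((extChartAt (𝓡 2) p).symm (extChartAt (𝓡 2) p p + (0 : ℝ) • b₂ a'))) = W p := by
    rw [hp0]
  have h2 := hsecond' _ hp0.symm _ hWc0
  -- (3) the first term is the Hessian
  have hhess := hessian_apply_holds (g := gN) (x := p) (f := f) (hf2 p) (hsp a') (hsp c)
  rw [localFrame_trivializationAt_self, localFrame_trivializationAt_self] at hhess
  rw [hhess, hessianAux]
  -- transport the goal to the base point of the line at `σ = 0`
  have key : ∀ q (hq : p = q) (w : TangentSpace (𝓡 2) q), (show EuclideanSpace ℝ (Fin 2) from w) =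
      b₂ c → g.val (F t₀ q)
      (show TangentSpace (𝓡 3) (F t₀ q) from covariantDerivAlong g.leviCivita
        (fun σ : ℝ ↦ F t₀ ((extChartAt (𝓡 2) p).symm (extChartAt (𝓡 2) p p + σ • b₂ a')))
        (fun σ ↦ mfderiv (𝓡 2) (𝓡 3) (F t₀)
          ((extChartAt (𝓡 2) p).symm (extChartAt (𝓡 2) p p + σ • b₂ a'))
          (W ((extChartAt (𝓡 2) p).symm (extChartAt (𝓡 2) p p + σ • b₂ a')))) 0)
      (mfderiv (𝓡 2) (𝓡 3) (F t₀) q w) =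
      g.val (F t₀ p)
      (show TangentSpace (𝓡 3) (F t₀ p) from covariantDerivAlong g.leviCivita
        (fun σ : ℝ ↦ F t₀ ((extChartAt (𝓡 2) p).symm (extChartAt (𝓡 2) p p + σ • b₂ a')))
        (fun σ ↦ mfderiv (𝓡 2) (𝓡 3) (F t₀)
          ((extChartAt (𝓡 2) p).symm (extChartAt (𝓡 2) p p + σ • b₂ a'))
          (W ((extChartAt (𝓡 2) p).symm (extChartAt (𝓡 2) p p + σ • b₂ a')))) 0)
      (mfderiv (𝓡 2) (𝓡 3) (F t₀) p (b₂ c)) := by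
    rintro q rfl w rfl; rfl
  have hsc0 : (show EuclideanSpace ℝ (Fin 2) from
      (trivializationAt (EuclideanSpace ℝ (Fin 2)) (TangentSpace (𝓡 2)) p).localFrame b₂ c
        ((extChartAt (𝓡 2) p).symm (extChartAt (𝓡 2) p p + (0 : ℝ) • b₂ a'))) = b₂ c := by
    rw [hp0, localFrame_trivializationAt_self]
  have h1 := key _ hp0.symm _ hsc0
  -- assemble
  have h3 : g.val (F t₀ p)
      (show TangentSpace (𝓡 3) (F t₀ p) from covariantDerivAlong g.leviCivita
        (fun σ : ℝ ↦ F t₀ ((extChartAt (𝓡 2) p).symm (extChartAt (𝓡 2) p p + σ • b₂ a')))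
        (fun σ ↦ mfderiv (𝓡 2) (𝓡 3) (F t₀)
          ((extChartAt (𝓡 2) p).symm (extChartAt (𝓡 2) p p + σ • b₂ a'))
          (W ((extChartAt (𝓡 2) p).symm (extChartAt (𝓡 2) p p + σ • b₂ a')))) 0)
      (mfderiv (𝓡 2) (𝓡 3) (F t₀) p (b₂ c)) =
      mvfderiv (𝓡 2) (fun y ↦ mvfderiv (𝓡 2) f y
        ((trivializationAt (EuclideanSpace ℝ (Fin 2)) (TangentSpace (𝓡 2)) p).localFrame b₂ c y)) p
        ((trivializationAt (EuclideanSpace ℝ (Fin 2)) (TangentSpace (𝓡 2)) p).localFrame b₂ a' p) -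
      mvfderiv (𝓡 2) f p (gN.leviCivita
        ((trivializationAt (EuclideanSpace ℝ (Fin 2)) (TangentSpace (𝓡 2)) p).localFrame b₂ c) p
        ((trivializationAt (EuclideanSpace ℝ (Fin 2)) (TangentSpace (𝓡 2)) p).localFrame b₂ a' p))
            := by
    rw [← h1, ← h2]
    have e0 := huniq
    linarith [e0]
  exact h3

/-- **`h(ν, D_v ν) = 0`**: the covariant derivative of the unit normal along a leaf is tangential
(differentiate `h(ν, ν) = 1` along the chart-straight curve with velocity `v`). O'Neill 1983,
Ch. 4, Lemma 4.19 ff. (shape operator). [cite: ONeill1983, Ch. 4, Lemma 4.19] -/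
theorem val_normal_normalDerivAlong (Hc : IsClassicalIMCF h hpb F ν a b) {t₀ : ℝ}
    (ht₀ : t₀ ∈ Set.Ioo a b) (p : S) (v : TangentSpace (𝓡 2) p) :
    (ofRiemannian h).val (F t₀ p) (ν t₀ p)
      ((ofRiemannian h).normalDerivAlong (F t₀) (ν t₀) p v) = 0 := by
  set g := ofRiemannian h with hg
  set c : ℝ → S := curveThrough (𝓡 2) p v with hc_def
  have hLC := isLeviCivita_leviCivita_holds (g := g)
  have hc0 : c 0 = p := curveThrough_zero (𝓡 2) p v
  have hνlift := Hc.mdifferentiableAt_lift_normal ht₀ p v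
  have hd := g.hasDerivAt_val_apply_along hLC.2 (γ := fun s ↦ F t₀ (c s))
    (V := fun s ↦ ν t₀ (c s)) (W := fun s ↦ ν t₀ (c s)) (t₀ := 0) hνlift hνlift
  have hconst : (fun s ↦ g.val (F t₀ (c s)) (ν t₀ (c s)) (ν t₀ (c s))) = fun _ ↦ (1 : ℝ) := by
    funext s; exact (Hc.isUnitNormal t₀ ht₀).val_self (c s)
  rw [hconst] at hd
  have h0 := hd.unique (hasDerivAt_const 0 (1 : ℝ))
  rw [g.symm (F t₀ (c 0))
    (covariantDerivAlong g.leviCivita (fun s ↦ F t₀ (c s)) (fun s ↦ ν t₀ (c s)) 0)] at h0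
  have key : ∀ z : S, p = z →
      g.val (F t₀ p) (ν t₀ p) (g.normalDerivAlong (F t₀) (ν t₀) p v) =
      g.val (F t₀ z) (ν t₀ z) (show TangentSpace (𝓡 3) (F t₀ z) from
        covariantDerivAlong g.leviCivita (fun s ↦ F t₀ (c s)) (fun s ↦ ν t₀ (c s)) 0) := by
    rintro z rfl; rfl
  rw [key _ hc0.symm]
  change g.val (F t₀ (c 0)) (ν t₀ (c 0))
    (covariantDerivAlong g.leviCivita (fun s ↦ F t₀ (c s)) (fun s ↦ ν t₀ (c s)) 0) = 0
  linarith

/-- **The normal term `h(D_v ν, D_t dF w) = H⁻¹ h(D_v ν, D_w ν)`.** For a classical solution,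
`t₀ ∈ (a, b)`, `p ∈ S` and `v, w ∈ T_p S`: the covariant derivative at `t₀` along `t ↦ F t p` of the
variation field `t ↦ ∂_σ|₀ F t (c_w σ) (= dF_t w)`, paired with `D_v ν`, equals
`H(t₀, p)⁻¹ h(D_v ν, D_w ν)` — by `D_t dF w = D_w(∂_t F) = w(H⁻¹) ν + H⁻¹ D_w ν` (symmetry lemma,
flow equation, Leibniz rule; as in `val_normal_covariantDerivAlong_velocity`) and `h(D_v ν, ν) = 0`.
Huisken–Ilmanen 2001, §1 (the term `H⁻¹ A²` in the evolution of `A` under (∗)).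
[cite: HuiskenIlmanenIMCF2001, §1 (1.1)–(1.3)] -/
theorem val_normalDerivAlong_covariantDerivAlong_velocity (Hc : IsClassicalIMCF h hpb F ν a b)
    {t₀ : ℝ} (ht₀ : t₀ ∈ Set.Ioo a b) (p : S) (v w : TangentSpace (𝓡 2) p) :
    (ofRiemannian h).val (F t₀ p) ((ofRiemannian h).normalDerivAlong (F t₀) (ν t₀) p v)
        (covariantDerivAlong (ofRiemannian h).leviCivita (fun t ↦ F t p)
          (fun t ↦ (velocity (𝓡 3) (fun s ↦ F t (curveThrough (𝓡 2) p w s)) 0 : E3)) t₀) =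
      ((ofRiemannian h).meanCurvature (F t₀) hpb (Hc.isSpacelikeImmersion t₀ ht₀) (ν t₀) p)⁻¹ *
        (ofRiemannian h).val (F t₀ p) ((ofRiemannian h).normalDerivAlong (F t₀) (ν t₀) p v)
          ((ofRiemannian h).normalDerivAlong (F t₀) (ν t₀) p w) := by
  set g := ofRiemannian h with hg
  set cov := g.leviCivita with hcov
  set c : ℝ → S := curveThrough (𝓡 2) p w with hc_def
  set φ : ℝ → ℝ := fun s ↦ (g.meanCurvature (F t₀) hpb (Hc.isSpacelikeImmersion t₀ ht₀) (ν t₀)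
    (c s))⁻¹ with hφ_def
  have hLC := isLeviCivita_leviCivita_holds (g := g)
  have hc0 : c 0 = p := curveThrough_zero (𝓡 2) p w
  set f₂ : ℝ → ℝ → X := fun t s ↦ F t (c s) with hf₂
  have hx : ContMDiffAt (𝓘(ℝ, ℝ).prod 𝓘(ℝ, ℝ)) (𝓡 3) 2 (uncurry f₂) (t₀, 0) :=
    Hc.contMDiffAt_uncurry_curveThrough ht₀ p w
  have hbase : (fun t ↦ f₂ t 0) = fun t ↦ F t p := by
    funext t; simp [hf₂, hc0]
  have hsymm : (covariantDerivAlong cov (fun t ↦ F t p)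
      (fun t ↦ (velocity (𝓡 3) (fun s ↦ F t (c s)) 0 : E3)) t₀ : E3) =
        covariantDerivAlong cov (fun s ↦ F t₀ (c s))
          (fun s ↦ velocity (𝓡 3) (fun t ↦ F t (c s)) t₀) 0 := by
    rw [← covariantDerivAlong_congr_base cov hbase
      (fun t ↦ (velocity (𝓡 3) (fun s ↦ F t (c s)) 0 : E3)) t₀]
    exact covariantDerivAlong_velocity_comm cov hLC.1 hx
  have hW : (fun s ↦ velocity (𝓡 3) (fun t ↦ F t (c s)) t₀) = fun s ↦ φ s • ν t₀ (c s) := by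
    funext s; exact Hc.velocity_eq t₀ ht₀ (c s)
  have hνlift := Hc.mdifferentiableAt_lift_normal ht₀ p w
  have hVlift : MDifferentiableAt 𝓘(ℝ, ℝ) (𝓡 3).tangent
      (fun s ↦ (TotalSpace.mk' E3 (F t₀ (c s)) (velocity (𝓡 3) (fun t ↦ F t (c s)) t₀) :
        TangentBundle (𝓡 3) X)) 0 :=
    mdifferentiableAt_lift_velocity_curry_left hx
  have hφeq : φ = fun s ↦ g.val (F t₀ (c s)) (velocity (𝓡 3) (fun t ↦ F t (c s)) t₀)
      (ν t₀ (c s)) := by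
    funext s; exact (Hc.val_velocity_normal ht₀ (c s)).symm
  have hφ : DifferentiableAt ℝ φ 0 := by
    rw [hφeq]; exact (g.hasDerivAt_val_apply_along hLC.2 hVlift hνlift).differentiableAt
  have hLeib := covariantDerivAlong_smul_holds cov (γ := fun s ↦ F t₀ (c s))
    (W := fun s ↦ ν t₀ (c s)) (f := φ) (t₀ := 0) hφ hνlift
  rw [hsymm, hW, hLeib]
  change g.val (F t₀ p) (g.normalDerivAlong (F t₀) (ν t₀) p v)
    (deriv φ 0 • (show TangentSpace (𝓡 3) (F t₀ p) from ν t₀ (c 0)) +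
    φ 0 • (show TangentSpace (𝓡 3) (F t₀ p) from
      covariantDerivAlong cov (fun s ↦ F t₀ (c s)) (fun s ↦ ν t₀ (c s)) 0)) = _
  rw [map_add, map_smul, map_smul, smul_eq_mul, smul_eq_mul]
  have key : ∀ z : S, p = z →
      g.val (F t₀ p) (g.normalDerivAlong (F t₀) (ν t₀) p v)
        (show TangentSpace (𝓡 3) (F t₀ p) from ν t₀ z) =
        g.val (F t₀ p) (g.normalDerivAlong (F t₀) (ν t₀) p v) (ν t₀ p) := by
    rintro z rfl; rfl
  have k2 : φ 0 = (g.meanCurvature (F t₀) hpb (Hc.isSpacelikeImmersion t₀ ht₀) (ν t₀) p)⁻¹ := by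
    simp [hφ_def, hc0]
  rw [key _ hc0.symm, k2, g.symm (F t₀ p) _ (ν t₀ p), Hc.val_normal_normalDerivAlong ht₀ p v,
    mul_zero, zero_add]
  rfl

/-- The unit normal along the two-parameter map `(τ, σ) ↦ F τ (c σ)` through the chart-straight
curve `c` at `p` with velocity `v` is a `C^∞` map into `TX` at `(t₀, 0)` (joint smoothness of the
normal, `contMDiffAt_lift_normal_chartFlow`, composed with `(τ, σ) ↦ (τ, φ p + σ v)`).
[cite: HuiskenIlmanenIMCF2001, §0 (∗)] -/
theorem contMDiffAt_lift_normal_uncurry_curveThrough (Hc : IsClassicalIMCF h hpb F ν a b)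
    {t₀ : ℝ} (ht₀ : t₀ ∈ Set.Ioo a b) (p : S) (v : TangentSpace (𝓡 2) p) :
    ContMDiffAt (𝓘(ℝ, ℝ).prod 𝓘(ℝ, ℝ)) (𝓡 3).tangent ∞
      (fun q : ℝ × ℝ ↦ (TotalSpace.mk' E3 (F q.1 (curveThrough (𝓡 2) p v q.2))
        (ν q.1 (curveThrough (𝓡 2) p v q.2)) : TangentBundle (𝓡 3) X)) (t₀, 0) := by
  have hq : ((t₀, extChartAt (𝓡 2) p p + (0 : ℝ) • (show EuclideanSpace ℝ (Fin 2) from v)) :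
      ℝ × EuclideanSpace ℝ (Fin 2)) ∈ Set.Ioo a b ×ˢ (extChartAt (𝓡 2) p).target := by
    refine ⟨ht₀, ?_⟩
    rw [zero_smul, add_zero]
    exact mem_extChartAt_target p
  have h1 := Hc.contMDiffAt_lift_normal_chartFlow (y₀ := p) hq
  have hψ : ContMDiffAt (𝓘(ℝ, ℝ).prod 𝓘(ℝ, ℝ)) (𝓘(ℝ, ℝ).prod 𝓘(ℝ, EuclideanSpace ℝ (Fin 2))) ∞
      (fun q : ℝ × ℝ ↦ ((q.1, extChartAt (𝓡 2) p p + q.2 • (show EuclideanSpace ℝ (Fin 2) from v)) :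
        ℝ × EuclideanSpace ℝ (Fin 2))) (t₀, 0) :=
    (contMDiffAt_fst (I := 𝓘(ℝ, ℝ)) (J := 𝓘(ℝ, ℝ))).prodMk
      ((contMDiffAt_const (I := 𝓘(ℝ, ℝ).prod 𝓘(ℝ, ℝ))).add
        ((contMDiffAt_snd (I := 𝓘(ℝ, ℝ)) (J := 𝓘(ℝ, ℝ))).smul
          (contMDiffAt_const (I := 𝓘(ℝ, ℝ).prod 𝓘(ℝ, ℝ)))))
  have h1' : ContMDiffAt (𝓘(ℝ, ℝ).prod 𝓘(ℝ, EuclideanSpace ℝ (Fin 2))) (𝓡 3).tangent ∞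
      (fun q' : ℝ × EuclideanSpace ℝ (Fin 2) ↦ (TotalSpace.mk' E3
        (F q'.1 ((extChartAt (𝓡 2) p).symm q'.2)) (ν q'.1 ((extChartAt (𝓡 2) p).symm q'.2)) :
          TangentBundle (𝓡 3) X))
      ((t₀, extChartAt (𝓡 2) p p + (0 : ℝ) • (show EuclideanSpace ℝ (Fin 2) from v)) :
        ℝ × EuclideanSpace ℝ (Fin 2)) := by
    rw [← modelWithCornersSelf_prod, chartedSpaceSelf_prod]
    exact h1
  exact h1'.comp (t₀, 0) hψ

/-- The lift `τ ↦ (F τ p, D_v ν_τ) ∈ TX` of the covariant derivative of the unit normal along the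
chart-straight curve with velocity `v` is differentiable at `t₀ ∈ (a, b)` (differentiability of
the `σ`-covariant derivative of the normal along the two-parameter map `(τ, σ) ↦ F τ (c σ)` in the
parameter `τ`, `mdifferentiableAt_lift_covariantDerivAlong_curry_right`).
[cite: HuiskenIlmanenIMCF2001, §0 (∗)] -/
theorem mdifferentiableAt_lift_normalDerivAlong_time (Hc : IsClassicalIMCF h hpb F ν a b)
    {t₀ : ℝ} (ht₀ : t₀ ∈ Set.Ioo a b) (p : S) (v : TangentSpace (𝓡 2) p) :
    MDifferentiableAt 𝓘(ℝ, ℝ) (𝓡 3).tangent (fun τ ↦ (TotalSpace.mk' E3 (F τ p)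
      ((ofRiemannian h).normalDerivAlong (F τ) (ν τ) p v : E3) : TangentBundle (𝓡 3) X)) t₀ := by
  set g := ofRiemannian h with hg
  set f₂ : ℝ → ℝ → X := fun t s ↦ F t (curveThrough (𝓡 2) p v s) with hf₂
  have hx : ContMDiffAt (𝓘(ℝ, ℝ).prod 𝓘(ℝ, ℝ)) (𝓡 3) 2 (uncurry f₂) (t₀, 0) :=
    Hc.contMDiffAt_uncurry_curveThrough ht₀ p v
  have hZ := (Hc.contMDiffAt_lift_normal_uncurry_curveThrough ht₀ p v).of_le
    (show (2 : WithTop ℕ∞) ≤ ∞ by exact WithTop.coe_le_coe.2 le_top)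
  have h1 := mdifferentiableAt_lift_covariantDerivAlong_curry_right (cov := g.leviCivita)
    (x := f₂) (Z := fun t s ↦ ν t (curveThrough (𝓡 2) p v s)) (t := t₀) (s := 0)
    (g.isLocallyContMDiff_leviCivita_holds 1 (by exact_mod_cast le_top)) hx hZ
  have hbase : (fun t ↦ f₂ t 0) = fun t ↦ F t p := by
    funext t; simp [hf₂, curveThrough_zero]
  exact mdifferentiableAt_lift_congr_base hbase h1

set_option maxHeartbeats 800000 in
/-- **`h(D_t D_{∂ₐ} ν, dF ∂_c) = −Hess(H⁻¹)(∂ₐ, ∂_c) + H⁻¹ h(R(ν, dF ∂ₐ)ν, dF ∂_c)`.** For a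
classical solution, `t₀ ∈ (a, b)`, `p ∈ S` and a basis `b₂` of the model plane: the covariant
derivative at `t₀` along `t ↦ F t p` of `t ↦ D_{b₂ a} ν_t` (covariant derivative of the unit normal
of the leaf `F_t` along the chart-straight curve `c` at `p` with velocity `b₂ a`), paired with
`dF_{t₀}(b₂ c)`. With `x(t, σ) = F t (c σ)` and `Z = ν` along `x`: `D_t D_σ Z = D_σ D_t Z +
R(x_t, x_σ) Z` (`covariantDerivAlong_covariantDerivAlong_sub_eq_curvature`, O'Neill 1983, Ch. 4,
Prop. 4.44 (2)), `D_t Z = −dF(grad H⁻¹)` along `c` (`covariantDerivAlong_normal_eq`), whose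
`σ`-derivative paired with `dF(b₂ c)` is the Hessian
(`val_covariantDerivAlong_mfderiv_grad_chartLine`), and `x_t = H⁻¹ ν`, `x_σ = dF(b₂ a)`.
Huisken–Ilmanen 2001, §1 (evolution of `A` under (∗)).
[cite: HuiskenIlmanenIMCF2001, §1 (1.1)–(1.3)] -/
theorem val_covariantDerivAlong_normalDerivAlong_time (Hc : IsClassicalIMCF h hpb F ν a b)
    {t₀ : ℝ} (ht₀ : t₀ ∈ Set.Ioo a b) (p : S) (b₂ : Module.Basis ι ℝ (EuclideanSpace ℝ (Fin 2)))
    (a' c : ι) :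
    haveI := ((ofRiemannian h).inducedMetric (F t₀) hpb (Hc.isSpacelikeImmersion t₀
        ht₀)).hasLeviCivita
    (ofRiemannian h).val (F t₀ p)
        (covariantDerivAlong (ofRiemannian h).leviCivita (fun t ↦ F t p)
          (fun t ↦ ((ofRiemannian h).normalDerivAlong (I' := 𝓡 2) (F t) (ν t) p (b₂ a') : E3)) t₀)
        (mfderiv (𝓡 2) (𝓡 3) (F t₀) p (b₂ c)) =
      -((ofRiemannian h).inducedMetric (F t₀) hpb (Hc.isSpacelikeImmersion t₀ ht₀)).hessian
          (fun y ↦ ((ofRiemannian h).meanCurvature (F t₀) hpb (Hc.isSpacelikeImmersion t₀ ht₀)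
            (ν t₀) y)⁻¹) p (b₂ a') (b₂ c) +
        ((ofRiemannian h).meanCurvature (F t₀) hpb (Hc.isSpacelikeImmersion t₀ ht₀) (ν t₀) p)⁻¹ *
          (ofRiemannian h).val (F t₀ p)
            ((ofRiemannian h).leviCivita.curvature (F t₀ p) (ν t₀ p)
              (mfderiv (𝓡 2) (𝓡 3) (F t₀) p (b₂ a')) (ν t₀ p))
            (mfderiv (𝓡 2) (𝓡 3) (F t₀) p (b₂ c)) := by
  set g := ofRiemannian h with hg
  set gN := g.inducedMetric (F t₀) hpb (Hc.isSpacelikeImmersion t₀ ht₀) with hgN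
  haveI := gN.hasLeviCivita
  set f : S → ℝ := fun y ↦ (g.meanCurvature (F t₀) hpb (Hc.isSpacelikeImmersion t₀ ht₀) (ν t₀) y)⁻¹
    with hf_def
  set W : Π y : S, TangentSpace (𝓡 2) y := fun y ↦ gN.sharp y (mvfderiv (𝓡 2) f y).toLinearMap
    with hW_def
  set cc : ℝ → S := curveThrough (𝓡 2) p (b₂ a') with hcc
  set f₂ : ℝ → ℝ → X := fun t s ↦ F t (cc s) with hf₂
  have hLC := isLeviCivita_leviCivita_holds (g := g)
  have hcov1 := g.isLocallyContMDiff_leviCivita_holds 1 (by exact_mod_cast le_top)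
  have hc0 : cc 0 = p := curveThrough_zero (𝓡 2) p (b₂ a')
  have hx : ContMDiffAt (𝓘(ℝ, ℝ).prod 𝓘(ℝ, ℝ)) (𝓡 3) 2 (uncurry f₂) (t₀, 0) :=
    Hc.contMDiffAt_uncurry_curveThrough ht₀ p (b₂ a')
  have hZ := (Hc.contMDiffAt_lift_normal_uncurry_curveThrough ht₀ p (b₂ a')).of_le
    (show (2 : WithTop ℕ∞) ≤ ∞ by exact WithTop.coe_le_coe.2 le_top)
  -- (1) transport of the base curve and the symmetry-with-curvature lemma
  have hbase : (fun t ↦ f₂ t 0) = fun t ↦ F t p := by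
    funext t; simp [hf₂, hc0]
  have hstep1 : (covariantDerivAlong g.leviCivita (fun t ↦ F t p)
      (fun t ↦ (g.normalDerivAlong (I' := 𝓡 2) (F t) (ν t) p (b₂ a') : E3)) t₀ : E3) =
      covariantDerivAlong g.leviCivita (fun t ↦ f₂ t 0)
        (fun t ↦ (covariantDerivAlong g.leviCivita (f₂ t) (fun s ↦ ν t (cc s)) 0 : E3)) t₀ := by
    exact (covariantDerivAlong_congr_base g.leviCivita hbase
      (fun t ↦ (covariantDerivAlong g.leviCivita (f₂ t) (fun s ↦ ν t (cc s)) 0 : E3)) t₀).symm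
  have hbr := covariantDerivAlong_covariantDerivAlong_sub_eq_curvature (cov := g.leviCivita)
    (x := f₂) (Z := fun t s ↦ ν t (cc s)) (t := t₀) (s := 0) hcov1 hx hZ
  -- (2) the mixed field is `-dF(W ∘ c)` (`D_t ν = -dF(grad H⁻¹)` pointwise along `c`)
  have hmix : (fun s' ↦ (covariantDerivAlong g.leviCivita (fun t' ↦ f₂ t' s') (fun t' ↦ ν t' (cc
      s'))
      t₀ : E3)) = fun s' ↦ (-1 : ℝ) • (mfderiv (𝓡 2) (𝓡 3) (F t₀) (cc s') (W (cc s')) : E3) := by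
    funext s'
    rw [neg_one_smul]
    exact Hc.covariantDerivAlong_normal_eq ht₀ (cc s')
  -- (3) `D_σ` of the mixed field is `-D_σ (dF (W ∘ c))`
  have hF2 : ContMDiff (𝓡 2) (𝓡 3) 2 (F t₀) :=
    (Hc.isSpacelikeImmersion t₀ ht₀).contMDiff_self.of_le (by exact WithTop.coe_le_coe.2 le_top)
  have hfs : ContMDiff (𝓡 2) 𝓘(ℝ, ℝ) ∞ f :=
    (Hc.contMDiff_meanCurvature ht₀).inv₀ fun y ↦ (Hc.meanCurvature_pos t₀ ht₀ y).ne'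
  have hf2 : ∀ y, ContMDiffAt (𝓡 2) 𝓘(ℝ, ℝ) 2 f y := fun y ↦
    (hfs y).of_le (by exact WithTop.coe_le_coe.2 le_top)
  have hW : ∀ y, MDifferentiableAt (𝓡 2) (𝓡 2).tangent (fun y ↦ (TotalSpace.mk'
      (EuclideanSpace ℝ (Fin 2)) y (W y) : TangentBundle (𝓡 2) S)) y := fun y ↦
    gN.mdifferentiableAt_sharp_mvfderiv (hf2 y)
  have hγ : MDifferentiableAt 𝓘(ℝ, ℝ) (𝓡 2) cc 0 :=
    (contMDiffAt_curveThrough_zero (n := 1) p (b₂ a')).mdifferentiableAt one_ne_zero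
  have hVl : MDifferentiableAt 𝓘(ℝ, ℝ) (𝓡 3).tangent (fun σ : ℝ ↦ (TotalSpace.mk' E3
      (F t₀ (cc σ)) (mfderiv (𝓡 2) (𝓡 3) (F t₀) (cc σ) (W (cc σ))) : TangentBundle (𝓡 3) X)) 0 :=
    mdifferentiableAt_lift_comp_curve (I := 𝓡 3) (f := F t₀)
      (Y := fun z ↦ mfderiv (𝓡 2) (𝓡 3) (F t₀) z (W z)) (c := cc) hγ
      (mdifferentiableAt_lift_mfderiv hF2 (hW _))
  have hLeib := covariantDerivAlong_smul_holds g.leviCivita (γ := fun σ ↦ F t₀ (cc σ))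
    (W := fun σ ↦ mfderiv (𝓡 2) (𝓡 3) (F t₀) (cc σ) (W (cc σ))) (f := fun _ ↦ (-1 : ℝ))
    (t₀ := 0) (differentiableAt_const _) hVl
  rw [deriv_const, zero_smul, zero_add] at hLeib
  have hB : (covariantDerivAlong g.leviCivita (f₂ t₀) (fun s' ↦ covariantDerivAlong g.leviCivita
      (fun t' ↦ f₂ t' s') (fun t' ↦ ν t' (cc s')) t₀) 0 : E3) =
      (-1 : ℝ) • (covariantDerivAlong g.leviCivita (fun σ ↦ F t₀ (cc σ))
        (fun σ ↦ mfderiv (𝓡 2) (𝓡 3) (F t₀) (cc σ) (W (cc σ))) 0 : E3) := by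
    have h1 := congrArg (fun V : ℝ → E3 ↦ (covariantDerivAlong g.leviCivita (f₂ t₀)
      (fun s' ↦ (V s' : TangentSpace (𝓡 3) (f₂ t₀ s'))) 0 : E3)) hmix
    exact h1.trans hLeib
  -- (4) the velocities of the two-parameter map at `(t₀, 0)`
  have hv1 : velocity (𝓡 3) (fun t' ↦ f₂ t' 0) t₀ =
      (g.meanCurvature (F t₀) hpb (Hc.isSpacelikeImmersion t₀ ht₀) (ν t₀) (cc 0))⁻¹ • ν t₀ (cc 0) :=
    Hc.velocity_eq t₀ ht₀ (cc 0)
  have hv2 : velocity (𝓡 3) (f₂ t₀) 0 = (mfderiv (𝓡 2) (𝓡 3) (F t₀) p (b₂ a') : E3) :=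
    Hc.velocity_comp_curveThrough ht₀ p (b₂ a')
  rw [hv1, hv2] at hbr
  -- (5) assemble, in the fibre at `F t₀ p`
  have hA : covariantDerivAlong g.leviCivita (fun t ↦ F t p)
      (fun t ↦ (g.normalDerivAlong (I' := 𝓡 2) (F t) (ν t) p (b₂ a') : E3)) t₀ =
      (-1 : ℝ) • (show TangentSpace (𝓡 3) (F t₀ p) from (covariantDerivAlong g.leviCivita
        (fun σ ↦ F t₀ (cc σ)) (fun σ ↦ mfderiv (𝓡 2) (𝓡 3) (F t₀) (cc σ) (W (cc σ))) 0 : E3)) +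
      (show TangentSpace (𝓡 3) (F t₀ p) from (g.leviCivita.curvature (F t₀ (cc 0))
        ((g.meanCurvature (F t₀) hpb (Hc.isSpacelikeImmersion t₀ ht₀) (ν t₀) (cc 0))⁻¹ • ν t₀ (cc
            0))
        (show TangentSpace (𝓡 3) (F t₀ (cc 0)) from (mfderiv (𝓡 2) (𝓡 3) (F t₀) p (b₂ a') : E3))
        (ν t₀ (cc 0)) : E3)) := by
    rw [hB] at hbr
    exact (hstep1.trans (sub_eq_iff_eq_add.1 hbr)).trans (add_comm _ _)
  -- the Hessian part
  have hX : g.val (F t₀ p) (show TangentSpace (𝓡 3) (F t₀ p) from (covariantDerivAlong g.leviCivita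
      (fun σ ↦ F t₀ (cc σ)) (fun σ ↦ mfderiv (𝓡 2) (𝓡 3) (F t₀) (cc σ) (W (cc σ))) 0 : E3))
      (mfderiv (𝓡 2) (𝓡 3) (F t₀) p (b₂ c)) = gN.hessian f p (b₂ a') (b₂ c) :=
    Hc.val_covariantDerivAlong_mfderiv_grad_chartLine ht₀ p b₂ a' c
  -- the curvature part, transported to `p`
  have hR : ∀ z (hz : p = z), g.val (F t₀ p) (show TangentSpace (𝓡 3) (F t₀ p) from
      (g.leviCivita.curvature (F t₀ z)
        ((g.meanCurvature (F t₀) hpb (Hc.isSpacelikeImmersion t₀ ht₀) (ν t₀) z)⁻¹ • ν t₀ z)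
        (show TangentSpace (𝓡 3) (F t₀ z) from (mfderiv (𝓡 2) (𝓡 3) (F t₀) p (b₂ a') : E3))
        (ν t₀ z) : E3)) (mfderiv (𝓡 2) (𝓡 3) (F t₀) p (b₂ c)) =
      (g.meanCurvature (F t₀) hpb (Hc.isSpacelikeImmersion t₀ ht₀) (ν t₀) p)⁻¹ *
        g.val (F t₀ p) (g.leviCivita.curvature (F t₀ p) (ν t₀ p)
          (mfderiv (𝓡 2) (𝓡 3) (F t₀) p (b₂ a')) (ν t₀ p)) (mfderiv (𝓡 2) (𝓡 3) (F t₀) p (b₂ c)) :=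
              by
    rintro z rfl
    change g.val (F t₀ p) (g.leviCivita.curvature (F t₀ p)
      ((g.meanCurvature (F t₀) hpb (Hc.isSpacelikeImmersion t₀ ht₀) (ν t₀) p)⁻¹ • ν t₀ p)
      (mfderiv (𝓡 2) (𝓡 3) (F t₀) p (b₂ a')) (ν t₀ p)) (mfderiv (𝓡 2) (𝓡 3) (F t₀) p (b₂ c)) = _
    rw [map_smul]
    simp only [_root_.smul_apply, map_smul, smul_eq_mul]
  rw [hA, map_add, map_smul, _root_.add_apply, _root_.smul_apply, hX,
    hR _ hc0.symm, smul_eq_mul]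
  ring

/-- **Evolution of the second fundamental form under inverse mean curvature flow** (Huisken–Ilmanen
2001, §1, the computation behind (1.3); Huisken–Polden, Thm. 3.2 with normal speed `H⁻¹`). For a
classical solution, `t₀ ∈ (a, b)`, `p ∈ S` and a basis `b₂` of the model plane, the component
`t ↦ K_{ν_t}(b₂ a, b₂ c)` of the second fundamental form of the leaf `F_t` at `p` is differentiable
at `t₀` with derivative
`−Hess_{g}(H⁻¹)(b₂ a, b₂ c) + H⁻¹ h(R(ν, dF b₂ a)ν, dF b₂ c) + H⁻¹ h(D_{b₂ a} ν, D_{b₂ c} ν)`,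
`g = F_{t₀}^* h`, `H = H(t₀, p)`: the product rule along `t ↦ F t p` for `K(b₂ a, b₂ c) =
h(D_{b₂ a} ν, dF b₂ c)` (`secondFundamentalForm_apply_holds`, `hasDerivAt_val_apply_along`) with
`val_covariantDerivAlong_normalDerivAlong_time` and
`val_normalDerivAlong_covariantDerivAlong_velocity`.
[cite: HuiskenIlmanenIMCF2001, §1 (1.1)–(1.3)] -/
theorem hasDerivAt_secondFundamentalForm (Hc : IsClassicalIMCF h hpb F ν a b)
    {t₀ : ℝ} (ht₀ : t₀ ∈ Set.Ioo a b) (p : S) (b₂ : Module.Basis ι ℝ (EuclideanSpace ℝ (Fin 2)))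
    (a' c : ι) :
    haveI := ((ofRiemannian h).inducedMetric (F t₀) hpb (Hc.isSpacelikeImmersion t₀
        ht₀)).hasLeviCivita
    HasDerivAt (fun t ↦ (ofRiemannian h).secondFundamentalForm (𝓡 2) (F t) (ν t) p (b₂ a') (b₂ c))
      (-((ofRiemannian h).inducedMetric (F t₀) hpb (Hc.isSpacelikeImmersion t₀ ht₀)).hessian
          (fun y ↦ ((ofRiemannian h).meanCurvature (F t₀) hpb (Hc.isSpacelikeImmersion t₀ ht₀)
            (ν t₀) y)⁻¹) p (b₂ a') (b₂ c) +
        ((ofRiemannian h).meanCurvature (F t₀) hpb (Hc.isSpacelikeImmersion t₀ ht₀) (ν t₀) p)⁻¹ *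
          (ofRiemannian h).val (F t₀ p)
            ((ofRiemannian h).leviCivita.curvature (F t₀ p) (ν t₀ p)
              (mfderiv (𝓡 2) (𝓡 3) (F t₀) p (b₂ a')) (ν t₀ p))
            (mfderiv (𝓡 2) (𝓡 3) (F t₀) p (b₂ c)) +
        ((ofRiemannian h).meanCurvature (F t₀) hpb (Hc.isSpacelikeImmersion t₀ ht₀) (ν t₀) p)⁻¹ *
          (ofRiemannian h).val (F t₀ p)
            ((ofRiemannian h).normalDerivAlong (I' := 𝓡 2) (F t₀) (ν t₀) p (b₂ a'))
            ((ofRiemannian h).normalDerivAlong (I' := 𝓡 2) (F t₀) (ν t₀) p (b₂ c))) t₀ := by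
  set g := ofRiemannian h with hg
  haveI := (g.inducedMetric (F t₀) hpb (Hc.isSpacelikeImmersion t₀ ht₀)).hasLeviCivita
  have hLC := isLeviCivita_leviCivita_holds (g := g)
  -- the two fields along `t ↦ F t p` and their lifts
  have hNl := Hc.mdifferentiableAt_lift_normalDerivAlong_time ht₀ p (b₂ a')
  have hVl : MDifferentiableAt 𝓘(ℝ, ℝ) (𝓡 3).tangent
      (fun t ↦ (TotalSpace.mk' E3 (F t p)
        (velocity (𝓡 3) (fun s ↦ F t (curveThrough (𝓡 2) p (b₂ c) s)) 0 : E3) :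
          TangentBundle (𝓡 3) X)) t₀ := by
    set f₂ : ℝ → ℝ → X := fun t s ↦ F t (curveThrough (𝓡 2) p (b₂ c) s) with hf₂
    have hbase : (fun t ↦ f₂ t 0) = fun t ↦ F t p := by
      funext t; simp [hf₂, curveThrough_zero]
    exact mdifferentiableAt_lift_congr_base hbase
      (mdifferentiableAt_lift_velocity_curry_right (Hc.contMDiffAt_uncurry_curveThrough ht₀ p (b₂
          c)))
  have hd := g.hasDerivAt_val_apply_along hLC.2 (γ := fun t ↦ F t p)
    (V := fun t ↦ (g.normalDerivAlong (I' := 𝓡 2) (F t) (ν t) p (b₂ a') : E3))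
    (W := fun t ↦ (velocity (𝓡 3) (fun s ↦ F t (curveThrough (𝓡 2) p (b₂ c) s)) 0 : E3))
    (t₀ := t₀) hNl hVl
  -- near `t₀` the paired function is the second fundamental form
  have heq : (fun t ↦ g.secondFundamentalForm (𝓡 2) (F t) (ν t) p (b₂ a') (b₂ c)) =ᶠ[𝓝 t₀]
      fun t ↦ g.val (F t p) (g.normalDerivAlong (I' := 𝓡 2) (F t) (ν t) p (b₂ a'))
        (velocity (𝓡 3) (fun s ↦ F t (curveThrough (𝓡 2) p (b₂ c) s)) 0 : E3) := by
    filter_upwards [isOpen_Ioo.mem_nhds ht₀] with t ht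
    rw [Hc.velocity_comp_curveThrough ht p (b₂ c)]
    exact secondFundamentalForm_apply_holds (g := g) (I' := 𝓡 2)
      BoundarylessManifold.isInteriorPoint (((Hc.contMDiff_normal t ht) p).mdifferentiableAt (by
          simp))
      (b₂ a') (b₂ c)
  refine (hd.congr_of_eventuallyEq heq).congr_deriv ?_
  rw [Hc.val_normalDerivAlong_covariantDerivAlong_velocity ht₀ p (b₂ a') (b₂ c),
    Hc.velocity_comp_curveThrough ht₀ p (b₂ c),
    Hc.val_covariantDerivAlong_normalDerivAlong_time ht₀ p b₂ a' c]

end IsClassicalIMCF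

end Literature.Geometry.Lorentzian

end
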